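import Literature.NumberTheory.ConnesConsani2021.SchwartzKernels
import Literature.Analysis.Fourier.DirichletIntegral
import HarnessLib

/-!
# The sine integral at infinity: `Si(x) → π/2`, with the rate `|Si(x) − π/2| ≤ 2/x`

LINE 1 — FRAMING: RH-FREE classical analysis (Dirichlet's integral `∫₀^∞ sin t/t dt = π/2` and the
integration-by-parts tail bound); cell rh-crit, corpus C1, seat t2 (gm-t15's 2026-08-26 request «W1» for
the `CC2021_prop_2_2_iii` programme, K3–K4 of its blueprint: the limits `S → ∞` of the `Si`-terms of the
exact finite-`S` trace identity); bears_on: W-C/W-P (apex (A), K1 boundary fact `CC2021_prop_2_2_iii`).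
WHAT THIS IS NOT: any claim about RH — nothing here bears on the truth of RH.

Topic `NumberTheory/ConnesConsani2021`; namespace `Literature.NumberTheory.ConnesConsani2021`.  Theorems only
(no definition, no named fact), about the tree's `sinIntegral x = ∫₀ˣ sin t/t dt` (`SchwartzKernels.lean`, the
`Si` of Connes–Consani 2021 §2 p. 11: "`Si` is positive", "`Si(x)/x ≤ 1`", the closed forms (25)–(26) of
`δ`):

* `tendsto_sinIntegral_atTop` — **`Si(x) → π/2` as `x → +∞`** (the generic
  `Literature.Analysis.Fourier.tendsto_intervalIntegral_sin_div_atTop`: Gaussian model + Riemann–Lebesgue);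
  `tendsto_sinIntegral_atBot` (`→ −π/2`);
* `sinIntegral_sub_sinIntegral_eq` — integration by parts
  `Si(y) − Si(x) = cos x/x − cos y/y − ∫ₓʸ cos t/t² dt` (`0 < x ≤ y`), whence
  `abs_sinIntegral_sub_sinIntegral_le` (`|Si(y) − Si(x)| ≤ 2/x`) and the rate
  **`abs_sinIntegral_sub_pi_div_two_le`**: `|Si(x) − π/2| ≤ 2/x` for `x > 0`;
* `tendsto_sinIntegral_div_self_atTop` (`Si(x)/x → 0`) and `tendsto_log_mul_sinIntegral_sub`
  (`log x · (Si(x) − π/2) → 0`, the form used when `Si(T) log T` is traded for `(π/2) log T`);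
* (append) the general integration-by-parts steps `integral_sin_div_pow_succ` / `integral_cos_div_pow_succ`,
  the fourth-order tail **`abs_sinIntegral_sub_expansion_le`**:
  `|Si(x) − (π/2 − cos x/x − sin x/x² + 2cos x/x³ + 6 sin x/x⁴)| ≤ 6/x⁴`, and the numerics-free enclosure
  **`abs_sinIntegral_four_pi_sub_le`**: `Si(4π) = π/2 − 1/(4π) + 2/(4π)³ ± 6/(4π)⁴` (the constant of
  `δ(1) = 2(Si(4π)/(4π)+1)` in Remark 4.6 (i), `traceRemainder_one`).

Not here (gm-t15's «W2», open): `∫₀^T Si(w)/w dw − (π/2) log T → (π/2)γ`, equivalently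
`∫₀^∞ log w · sin w / w dw = −πγ/2` (Gradshteyn–Ryzhik 4.421 1).

## References

* R. Courant, E. J. McShane, *Differential and Integral Calculus* Vol. II (Wiley 1988), Ch. IV Appendix §1,
  Example 1 "Dirichlet's discontinuous factor" (PDF p. 236): `(2/π)∫₀^∞ sin τ cos(τx)/τ dτ = 1` for `x² < 1`.
  [CourantMcshane1988]
* E. C. Titchmarsh, *Introduction to the Theory of Fourier Integrals*, 2nd ed. (1948), §1.9. [Titchmarsh1948]
* A. Connes, C. Consani, Selecta Math. 27 (2021) 77, §2 p. 11 (the `Si`-terms of `δ`, eqs. (25)–(26);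
  arXiv:2006.13771 chunk p0011). [ConnesConsani2021]
-/

noncomputable section

open Filter Topology Set MeasureTheory intervalIntegral
open scoped Real

namespace Literature.NumberTheory.ConnesConsani2021

open Literature.Analysis.Fourier

/-- **`Si(x) → π/2` as `x → +∞`** (Dirichlet's integral `∫₀^∞ sin t/t dt = π/2`).
[cite: CourantMcshane1988, Vol. II Ch. IV Appendix §1 Example 1 (PDF p. 236); Titchmarsh1948, §1.9; ConnesConsani2021, §2 p. 11 (chunk p0011:L10)] -/
theorem tendsto_sinIntegral_atTop : Tendsto sinIntegral atTop (𝓝 (π / 2)) :=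
  tendsto_intervalIntegral_sin_div_atTop

/-- `Si(x) → −π/2` as `x → −∞` (`Si` is odd).
[cite: CourantMcshane1988, Vol. II Ch. IV Appendix §1 Example 1 (PDF p. 236); ConnesConsani2021, §2 p. 11 (chunk p0011:L10)] -/
theorem tendsto_sinIntegral_atBot : Tendsto sinIntegral atBot (𝓝 (-(π / 2))) :=
  tendsto_intervalIntegral_sin_div_atBot

/-- `Si(x)/x → 0` as `x → +∞`. [cite: ConnesConsani2021, §2 p. 11 (chunk p0011:L47: "`Si(x)/x ≤ 1`", decay of `δ`)] -/
theorem tendsto_sinIntegral_div_self_atTop : Tendsto (fun x : ℝ => sinIntegral x / x) atTop (𝓝 0) := by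
  have h : Tendsto (fun x : ℝ => (5 : ℝ) * x⁻¹) atTop (𝓝 0) := by
    simpa using tendsto_inv_atTop_zero.const_mul (5 : ℝ)
  refine squeeze_zero_norm' ?_ h
  filter_upwards [eventually_gt_atTop 0] with x hx
  rw [Real.norm_eq_abs, abs_div, abs_of_pos hx, div_eq_mul_inv]
  exact mul_le_mul_of_nonneg_right (abs_sinIntegral_le_five x) (inv_nonneg.2 hx.le)

/-! ### Integration by parts on `[x, y] ⊂ (0, ∞)` and the rate `2/x` -/

/-- `|sin t / t| ≤ 1`. [cite: ConnesConsani2021, §2 p. 11 (chunk p0011:L47)] -/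
theorem abs_sin_div_self_le_one (t : ℝ) : |Real.sin t / t| ≤ 1 := by
  rw [abs_div]
  rcases eq_or_ne t 0 with rfl | ht
  · simp
  · rw [div_le_one (abs_pos.2 ht)]
    exact Real.abs_sin_le_abs

/-- `sin t / t` is interval integrable (bounded by `1`). [cite: ConnesConsani2021, §2 p. 11 (chunk p0011:L10)] -/
theorem intervalIntegrable_sin_div_self (a b : ℝ) :
    IntervalIntegrable (fun t : ℝ => Real.sin t / t) volume a b :=
  (intervalIntegrable_const (c := (1 : ℝ))).mono_fun' (Measurable.aestronglyMeasurable (by fun_prop))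
    (Filter.Eventually.of_forall fun t => by
      show ‖Real.sin t / t‖ ≤ 1
      rw [Real.norm_eq_abs]; exact abs_sin_div_self_le_one t)

/-- `Si(y) − Si(x) = ∫ₓʸ sin t/t dt`. [cite: ConnesConsani2021, §2 p. 11 (chunk p0011:L10)] -/
theorem sinIntegral_sub_sinIntegral (x y : ℝ) :
    sinIntegral y - sinIntegral x = ∫ t in x..y, Real.sin t / t := by
  unfold sinIntegral
  rw [integral_interval_sub_left (intervalIntegrable_sin_div_self 0 y) (intervalIntegrable_sin_div_self 0 x)]

/-- **Integration by parts**: for `0 < x ≤ y`,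
`Si(y) − Si(x) = cos x/x − cos y/y − ∫ₓʸ cos t/t² dt`. [cite: Titchmarsh1948, §1.9; ConnesConsani2021, §2 p. 11 (chunk p0011:L10)] -/
theorem sinIntegral_sub_sinIntegral_eq {x y : ℝ} (hx : 0 < x) (hxy : x ≤ y) :
    sinIntegral y - sinIntegral x =
      Real.cos x / x - Real.cos y / y - ∫ t in x..y, Real.cos t / t ^ 2 := by
  rw [sinIntegral_sub_sinIntegral]
  have hpos : ∀ t ∈ uIcc x y, 0 < t := by
    intro t ht
    rw [uIcc_of_le hxy] at ht
    exact lt_of_lt_of_le hx ht.1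
  -- `u = t⁻¹`, `v = −cos t`
  have hu : ∀ t ∈ uIcc x y, HasDerivAt (fun t : ℝ => t⁻¹) (-(t ^ 2)⁻¹) t := fun t ht =>
    hasDerivAt_inv (hpos t ht).ne'
  have hv : ∀ t ∈ uIcc x y, HasDerivAt (fun t : ℝ => -Real.cos t) (Real.sin t) t := fun t _ => by
    have h := (Real.hasDerivAt_cos t).fun_neg
    rwa [neg_neg] at h
  have hcont : ContinuousOn (fun t : ℝ => (t ^ 2)⁻¹) (uIcc x y) :=
    (continuousOn_pow 2).inv₀ fun t ht => pow_ne_zero 2 (hpos t ht).ne'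
  have hu' : IntervalIntegrable (fun t : ℝ => -(t ^ 2)⁻¹) volume x y :=
    (ContinuousOn.intervalIntegrable hcont).neg
  have hv' : IntervalIntegrable (fun t : ℝ => Real.sin t) volume x y :=
    Real.continuous_sin.intervalIntegrable _ _
  have hparts := integral_mul_deriv_eq_deriv_mul hu hv hu' hv'
  have e1 : ∫ t in x..y, Real.sin t / t = ∫ t in x..y, t⁻¹ * Real.sin t :=
    integral_congr fun t _ => by simp only [div_eq_inv_mul]
  have e2 : ∫ t in x..y, -(t ^ 2)⁻¹ * -Real.cos t = ∫ t in x..y, Real.cos t / t ^ 2 :=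
    integral_congr fun t _ => by simp only [div_eq_inv_mul, neg_mul_neg]
  rw [e1, hparts, e2]
  simp only [div_eq_inv_mul]
  ring

/-- `|∫ₓʸ cos t/t² dt| ≤ 1/x − 1/y` for `0 < x ≤ y`. [cite: Titchmarsh1948, §1.9] -/
theorem abs_integral_cos_div_sq_le {x y : ℝ} (hx : 0 < x) (hxy : x ≤ y) :
    |∫ t in x..y, Real.cos t / t ^ 2| ≤ x⁻¹ - y⁻¹ := by
  have hpos : ∀ t ∈ uIcc x y, 0 < t := by
    intro t ht
    rw [uIcc_of_le hxy] at ht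
    exact lt_of_lt_of_le hx ht.1
  have hF : ∀ t ∈ uIcc x y, HasDerivAt (fun t : ℝ => -t⁻¹) ((t ^ 2)⁻¹) t := by
    intro t ht
    have h := (hasDerivAt_inv (hpos t ht).ne').fun_neg
    rwa [neg_neg] at h
  have hint : IntervalIntegrable (fun t : ℝ => (t ^ 2)⁻¹) volume x y :=
    ContinuousOn.intervalIntegrable ((continuousOn_pow 2).inv₀ fun t ht => pow_ne_zero 2 (hpos t ht).ne')
  have hval : ∫ t in x..y, (t ^ 2)⁻¹ = x⁻¹ - y⁻¹ := by
    rw [integral_eq_sub_of_hasDerivAt hF hint]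
    ring
  have h := norm_integral_le_of_norm_le (μ := volume) (f := fun t : ℝ => Real.cos t / t ^ 2) hxy
    (Filter.Eventually.of_forall fun t ht => ?_) hint
  · rw [hval, Real.norm_eq_abs] at h
    exact h
  · have ht0 : 0 < t := hx.trans ht.1
    rw [Real.norm_eq_abs, abs_div, abs_of_pos (pow_pos ht0 2), div_eq_mul_inv]
    exact mul_le_of_le_one_left (inv_nonneg.2 (pow_pos ht0 2).le) (Real.abs_cos_le_one t)

/-- `|Si(y) − Si(x)| ≤ 2/x` for `0 < x ≤ y` (the Cauchy tail of Dirichlet's integral).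
[cite: Titchmarsh1948, §1.9; ConnesConsani2021, §2 p. 11 (chunk p0011:L47)] -/
theorem abs_sinIntegral_sub_sinIntegral_le {x y : ℝ} (hx : 0 < x) (hxy : x ≤ y) :
    |sinIntegral y - sinIntegral x| ≤ 2 / x := by
  have hy : 0 < y := lt_of_lt_of_le hx hxy
  rw [sinIntegral_sub_sinIntegral_eq hx hxy]
  have h1 : |Real.cos x / x| ≤ x⁻¹ := by
    rw [abs_div, abs_of_pos hx, div_eq_mul_inv]
    exact mul_le_of_le_one_left (inv_nonneg.2 hx.le) (Real.abs_cos_le_one x)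
  have h2 : |Real.cos y / y| ≤ y⁻¹ := by
    rw [abs_div, abs_of_pos hy, div_eq_mul_inv]
    exact mul_le_of_le_one_left (inv_nonneg.2 hy.le) (Real.abs_cos_le_one y)
  have h3 := abs_integral_cos_div_sq_le hx hxy
  calc |Real.cos x / x - Real.cos y / y - ∫ t in x..y, Real.cos t / t ^ 2|
      ≤ |Real.cos x / x| + |Real.cos y / y| + |∫ t in x..y, Real.cos t / t ^ 2| := by
        have := abs_sub (Real.cos x / x - Real.cos y / y) (∫ t in x..y, Real.cos t / t ^ 2)
        have := abs_sub (Real.cos x / x) (Real.cos y / y)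
        linarith
    _ ≤ x⁻¹ + y⁻¹ + (x⁻¹ - y⁻¹) := by linarith
    _ = 2 / x := by ring

/-- **The rate**: `|Si(x) − π/2| ≤ 2/x` for `x > 0` (let `y → ∞` in `abs_sinIntegral_sub_sinIntegral_le`).
[cite: Titchmarsh1948, §1.9; CourantMcshane1988, Vol. II Ch. IV Appendix §1 Example 1 (PDF p. 236)] -/
theorem abs_sinIntegral_sub_pi_div_two_le {x : ℝ} (hx : 0 < x) :
    |sinIntegral x - π / 2| ≤ 2 / x := by
  have hlim : Tendsto (fun y : ℝ => |sinIntegral y - sinIntegral x|) atTop (𝓝 |π / 2 - sinIntegral x|) :=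
    ((tendsto_sinIntegral_atTop.sub_const (sinIntegral x)).abs)
  have hle : ∀ᶠ y in atTop, |sinIntegral y - sinIntegral x| ≤ 2 / x := by
    filter_upwards [eventually_ge_atTop x] with y hy
    exact abs_sinIntegral_sub_sinIntegral_le hx hy
  have := le_of_tendsto hlim hle
  rwa [abs_sub_comm] at this

/-- `log x · (Si(x) − π/2) → 0` as `x → +∞` (so `Si(T) log T = (π/2) log T + o(1)`, the form in which
the `Si`-boundary terms are traded for logarithms). [cite: Titchmarsh1948, §1.9] -/
theorem tendsto_log_mul_sinIntegral_sub :
    Tendsto (fun x : ℝ => Real.log x * (sinIntegral x - π / 2)) atTop (𝓝 0) := by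
  have h0 : Tendsto (fun x : ℝ => Real.log x ^ 1 / (1 * x + 0)) atTop (𝓝 0) :=
    Real.tendsto_pow_log_div_mul_add_atTop 1 0 1 one_ne_zero
  have h1 : Tendsto (fun x : ℝ => 2 * (Real.log x ^ 1 / (1 * x + 0))) atTop (𝓝 0) := by
    simpa using h0.const_mul 2
  refine squeeze_zero_norm' ?_ h1
  filter_upwards [eventually_ge_atTop 1] with x hx
  have hx0 : 0 < x := by linarith
  rw [norm_mul, Real.norm_eq_abs, Real.norm_eq_abs, abs_of_nonneg (Real.log_nonneg hx), pow_one, one_mul,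
    add_zero]
  calc Real.log x * |sinIntegral x - π / 2| ≤ Real.log x * (2 / x) :=
        mul_le_mul_of_nonneg_left (abs_sinIntegral_sub_pi_div_two_le hx0) (Real.log_nonneg hx)
    _ = 2 * (Real.log x / x) := by ring

/-! ### Higher-order tails: `π/2 − Si(x) = cos x/x + sin x/x² − 2cos x/x³ − 6 sin x/x⁴ + O(6/x⁴)`
(append, 2026-08-26: repeated integration by parts; at `x = 4π` this encloses `Si(4π)` — the constant of
`δ(1) = 2(Si(4π)/(4π) + 1)`, `traceRemainder_one` — to `± 6/(4π)⁴` without any numerics) -/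

section HigherOrder

/-- One integration by parts, sine form: for `0 < x ≤ y`,
`∫ₓʸ sin t/t^{k+1} dt = cos x/x^{k+1} − cos y/y^{k+1} − (k+1)∫ₓʸ cos t/t^{k+2} dt`.
[cite: Titchmarsh1948, §1.9] -/
theorem integral_sin_div_pow_succ {x y : ℝ} (hx : 0 < x) (hxy : x ≤ y) (k : ℕ) :
    ∫ t in x..y, Real.sin t / t ^ (k + 1) =
      Real.cos x / x ^ (k + 1) - Real.cos y / y ^ (k + 1) -
        (k + 1) * ∫ t in x..y, Real.cos t / t ^ (k + 2) := by
  have hpos : ∀ t ∈ uIcc x y, 0 < t := by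
    intro t ht
    rw [uIcc_of_le hxy] at ht
    exact lt_of_lt_of_le hx ht.1
  have hu : ∀ t ∈ uIcc x y, HasDerivAt (fun t : ℝ => (t ^ (k + 1))⁻¹)
      (-((k + 1 : ℕ) * t ^ k) / (t ^ (k + 1)) ^ 2) t := fun t ht =>
    (hasDerivAt_pow (k + 1) t).fun_inv (pow_ne_zero _ (hpos t ht).ne')
  have hv : ∀ t ∈ uIcc x y, HasDerivAt (fun t : ℝ => -Real.cos t) (Real.sin t) t := fun t _ => by
    have h := (Real.hasDerivAt_cos t).fun_neg
    rwa [neg_neg] at h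
  have hcont : ContinuousOn (fun t : ℝ => -((k + 1 : ℕ) * t ^ k) / (t ^ (k + 1)) ^ 2) (uIcc x y) := by
    refine ContinuousOn.div (by fun_prop) (by fun_prop) fun t ht => ?_
    exact pow_ne_zero 2 (pow_ne_zero _ (hpos t ht).ne')
  have hparts := integral_mul_deriv_eq_deriv_mul hu hv (ContinuousOn.intervalIntegrable hcont)
    (Real.continuous_sin.intervalIntegrable _ _)
  have e1 : ∫ t in x..y, Real.sin t / t ^ (k + 1) = ∫ t in x..y, (t ^ (k + 1))⁻¹ * Real.sin t :=
    integral_congr fun t _ => by simp only [div_eq_inv_mul]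
  have e2 : ∫ t in x..y, -((k + 1 : ℕ) * t ^ k) / (t ^ (k + 1)) ^ 2 * -Real.cos t =
      (k + 1) * ∫ t in x..y, Real.cos t / t ^ (k + 2) := by
    rw [← intervalIntegral.integral_const_mul]
    refine integral_congr fun t ht => ?_
    have ht0 : t ≠ 0 := (hpos t ht).ne'
    simp only [Nat.cast_add, Nat.cast_one]
    field_simp
    ring
  rw [e1, hparts, e2]
  simp only [div_eq_inv_mul]
  ring

/-- One integration by parts, cosine form: for `0 < x ≤ y`,
`∫ₓʸ cos t/t^{k+1} dt = sin y/y^{k+1} − sin x/x^{k+1} + (k+1)∫ₓʸ sin t/t^{k+2} dt`.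
[cite: Titchmarsh1948, §1.9] -/
theorem integral_cos_div_pow_succ {x y : ℝ} (hx : 0 < x) (hxy : x ≤ y) (k : ℕ) :
    ∫ t in x..y, Real.cos t / t ^ (k + 1) =
      Real.sin y / y ^ (k + 1) - Real.sin x / x ^ (k + 1) +
        (k + 1) * ∫ t in x..y, Real.sin t / t ^ (k + 2) := by
  have hpos : ∀ t ∈ uIcc x y, 0 < t := by
    intro t ht
    rw [uIcc_of_le hxy] at ht
    exact lt_of_lt_of_le hx ht.1
  have hu : ∀ t ∈ uIcc x y, HasDerivAt (fun t : ℝ => (t ^ (k + 1))⁻¹)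
      (-((k + 1 : ℕ) * t ^ k) / (t ^ (k + 1)) ^ 2) t := fun t ht =>
    (hasDerivAt_pow (k + 1) t).fun_inv (pow_ne_zero _ (hpos t ht).ne')
  have hv : ∀ t ∈ uIcc x y, HasDerivAt (fun t : ℝ => Real.sin t) (Real.cos t) t := fun t _ =>
    Real.hasDerivAt_sin t
  have hcont : ContinuousOn (fun t : ℝ => -((k + 1 : ℕ) * t ^ k) / (t ^ (k + 1)) ^ 2) (uIcc x y) := by
    refine ContinuousOn.div (by fun_prop) (by fun_prop) fun t ht => ?_
    exact pow_ne_zero 2 (pow_ne_zero _ (hpos t ht).ne')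
  have hparts := integral_mul_deriv_eq_deriv_mul hu hv (ContinuousOn.intervalIntegrable hcont)
    (Real.continuous_cos.intervalIntegrable _ _)
  have e1 : ∫ t in x..y, Real.cos t / t ^ (k + 1) = ∫ t in x..y, (t ^ (k + 1))⁻¹ * Real.cos t :=
    integral_congr fun t _ => by simp only [div_eq_inv_mul]
  have e2 : ∫ t in x..y, -((k + 1 : ℕ) * t ^ k) / (t ^ (k + 1)) ^ 2 * Real.sin t =
      -((k + 1) * ∫ t in x..y, Real.sin t / t ^ (k + 2)) := by
    rw [← intervalIntegral.integral_const_mul, ← intervalIntegral.integral_neg]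
    refine integral_congr fun t ht => ?_
    have ht0 : t ≠ 0 := (hpos t ht).ne'
    simp only [Nat.cast_add, Nat.cast_one]
    field_simp
    ring
  rw [e1, hparts, e2]
  simp only [div_eq_inv_mul]
  ring

/-- `|∫ₓʸ f(t)/t^{k+2} dt| ≤ 1/((k+1) x^{k+1})` for `|f| ≤ 1` and `0 < x ≤ y` (no integrability needed:
the bound holds trivially for the junk value `0` too).
[cite: Titchmarsh1948, §1.9] -/
theorem abs_integral_div_pow_le {f : ℝ → ℝ} (hf1 : ∀ t, |f t| ≤ 1) {x y : ℝ}
    (hx : 0 < x) (hxy : x ≤ y) (k : ℕ) :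
    |∫ t in x..y, f t / t ^ (k + 2)| ≤ 1 / ((k + 1) * x ^ (k + 1)) := by
  have hpos : ∀ t ∈ uIcc x y, 0 < t := by
    intro t ht
    rw [uIcc_of_le hxy] at ht
    exact lt_of_lt_of_le hx ht.1
  have hy : 0 < y := lt_of_lt_of_le hx hxy
  -- antiderivative of `t^{-(k+2)}`: `−(k+1)⁻¹ · t^{-(k+1)}`
  have hF : ∀ t ∈ uIcc x y, HasDerivAt (fun t : ℝ => -(1 / (k + 1 : ℝ)) * (t ^ (k + 1))⁻¹)
      ((t ^ (k + 2))⁻¹) t := by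
    intro t ht
    have ht0 : t ≠ 0 := (hpos t ht).ne'
    have h1 : HasDerivAt (fun t : ℝ => (t ^ (k + 1))⁻¹) (-((k + 1 : ℕ) * t ^ k) / (t ^ (k + 1)) ^ 2) t :=
      (hasDerivAt_pow (k + 1) t).fun_inv (pow_ne_zero _ ht0)
    refine (h1.const_mul (-(1 / (k + 1 : ℝ)))).congr_deriv ?_
    simp only [Nat.cast_add, Nat.cast_one]
    field_simp
    ring
  have hint : IntervalIntegrable (fun t : ℝ => (t ^ (k + 2))⁻¹) volume x y :=
    ContinuousOn.intervalIntegrable ((continuousOn_pow (k + 2)).inv₀ fun t ht => pow_ne_zero _ (hpos t ht).ne')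
  have hval : ∫ t in x..y, (t ^ (k + 2))⁻¹ =
      1 / ((k + 1) * x ^ (k + 1)) - 1 / ((k + 1) * y ^ (k + 1)) := by
    rw [integral_eq_sub_of_hasDerivAt hF hint]
    have hx0 : x ≠ 0 := hx.ne'
    have hy0 : y ≠ 0 := hy.ne'
    field_simp
    ring
  have h := norm_integral_le_of_norm_le (μ := volume) (f := fun t : ℝ => f t / t ^ (k + 2)) hxy
    (Filter.Eventually.of_forall fun t ht => ?_) hint
  · rw [hval, Real.norm_eq_abs] at h
    have : 0 ≤ 1 / ((k + 1) * y ^ (k + 1)) := by positivity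
    linarith
  · have ht0 : 0 < t := hx.trans ht.1
    rw [Real.norm_eq_abs, abs_div, abs_of_pos (pow_pos ht0 _), div_eq_mul_inv]
    exact mul_le_of_le_one_left (inv_nonneg.2 (pow_pos ht0 _).le) (hf1 t)

/-- **Four integrations by parts**: for `0 < x ≤ y`,
`Si(y) − Si(x) = (cos x/x + sin x/x² − 2cos x/x³ − 6 sin x/x⁴) − (cos y/y + sin y/y² − 2cos y/y³ − 6 sin y/y⁴)
  + 24 ∫ₓʸ sin t/t⁵ dt`. [cite: Titchmarsh1948, §1.9] -/
theorem sinIntegral_sub_sinIntegral_eq_four {x y : ℝ} (hx : 0 < x) (hxy : x ≤ y) :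
    sinIntegral y - sinIntegral x =
      (Real.cos x / x + Real.sin x / x ^ 2 - 2 * Real.cos x / x ^ 3 - 6 * Real.sin x / x ^ 4)
        - (Real.cos y / y + Real.sin y / y ^ 2 - 2 * Real.cos y / y ^ 3 - 6 * Real.sin y / y ^ 4)
        + 24 * ∫ t in x..y, Real.sin t / t ^ 5 := by
  have h1 := integral_sin_div_pow_succ hx hxy 0
  have h2 := integral_cos_div_pow_succ hx hxy 1
  have h3 := integral_sin_div_pow_succ hx hxy 2
  have h4 := integral_cos_div_pow_succ hx hxy 3
  rw [sinIntegral_sub_sinIntegral]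
  have e0 : ∫ t in x..y, Real.sin t / t = ∫ t in x..y, Real.sin t / t ^ (0 + 1) :=
    integral_congr fun t _ => by simp
  rw [e0, h1]
  norm_num at h2 h3 h4 ⊢
  rw [h2, h3, h4]
  ring

/-- **The rate to fourth order**: for `x > 0`,
`|Si(x) − (π/2 − cos x/x − sin x/x² + 2cos x/x³ + 6 sin x/x⁴)| ≤ 6/x⁴`.
[cite: Titchmarsh1948, §1.9; CourantMcshane1988, Vol. II Ch. IV Appendix §1 Example 1 (PDF p. 236)] -/
theorem abs_sinIntegral_sub_expansion_le {x : ℝ} (hx : 0 < x) :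
    |sinIntegral x -
        (π / 2 - Real.cos x / x - Real.sin x / x ^ 2 + 2 * Real.cos x / x ^ 3 + 6 * Real.sin x / x ^ 4)|
      ≤ 6 / x ^ 4 := by
  set A : ℝ := Real.cos x / x + Real.sin x / x ^ 2 - 2 * Real.cos x / x ^ 3 - 6 * Real.sin x / x ^ 4
    with hA
  set B : ℝ → ℝ := fun y =>
    Real.cos y / y + Real.sin y / y ^ 2 - 2 * Real.cos y / y ^ 3 - 6 * Real.sin y / y ^ 4 with hB
  -- the `y`-terms tend to `0`
  have hB0 : Tendsto B atTop (𝓝 0) := by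
    have hb : ∀ (c : ℝ) (j : ℕ) (f : ℝ → ℝ), (∀ t, |f t| ≤ 1) →
        Tendsto (fun y : ℝ => c * f y / y ^ (j + 1)) atTop (𝓝 0) := by
      intro c j f hf
      have h0 : Tendsto (fun y : ℝ => |c| * (y ^ (j + 1))⁻¹) atTop (𝓝 0) := by
        simpa using (tendsto_inv_atTop_zero.comp (tendsto_pow_atTop (by omega))).const_mul |c|
      refine squeeze_zero_norm' ?_ h0
      filter_upwards [eventually_gt_atTop 0] with y hy
      rw [Real.norm_eq_abs, abs_div, abs_mul, abs_of_pos (pow_pos hy _), div_eq_mul_inv]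
      exact mul_le_mul_of_nonneg_right (mul_le_of_le_one_right (abs_nonneg c) (hf y))
        (inv_nonneg.2 (pow_pos hy _).le)
    have t1 := hb 1 0 Real.cos Real.abs_cos_le_one
    have t2 := hb 1 1 Real.sin Real.abs_sin_le_one
    have t3 := hb 2 2 Real.cos Real.abs_cos_le_one
    have t4 := hb 6 3 Real.sin Real.abs_sin_le_one
    have := ((t1.add t2).sub t3).sub t4
    simp only [add_zero, sub_zero] at this
    refine this.congr fun y => ?_
    simp only [hB, zero_add, Nat.reduceAdd, pow_one, one_mul]
  -- for `y ≥ x`: `|Si y − Si x − A + B y| ≤ 6/x⁴`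
  have hle : ∀ᶠ y in atTop, |sinIntegral y - sinIntegral x - A + B y| ≤ 6 / x ^ 4 := by
    filter_upwards [eventually_ge_atTop x] with y hy
    have hI := abs_integral_div_pow_le Real.abs_sin_le_one hx hy 3
    have e : sinIntegral y - sinIntegral x - A + B y = 24 * ∫ t in x..y, Real.sin t / t ^ 5 := by
      rw [sinIntegral_sub_sinIntegral_eq_four hx hy, hA, hB]
      ring
    rw [e, abs_mul, abs_of_pos (by norm_num : (0 : ℝ) < 24)]
    norm_num at hI ⊢
    calc 24 * |∫ t in x..y, Real.sin t / t ^ 5| ≤ 24 * ((x ^ 4)⁻¹ * (1 / 4)) := by gcongr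
      _ = 6 / x ^ 4 := by ring
  have hlim : Tendsto (fun y : ℝ => |sinIntegral y - sinIntegral x - A + B y|) atTop
      (𝓝 |π / 2 - sinIntegral x - A + 0|) :=
    (((tendsto_sinIntegral_atTop.sub_const (sinIntegral x)).sub_const A).add hB0).abs
  have := le_of_tendsto hlim hle
  rw [add_zero] at this
  have e2 : sinIntegral x - (π / 2 - Real.cos x / x - Real.sin x / x ^ 2 + 2 * Real.cos x / x ^ 3 +
      6 * Real.sin x / x ^ 4) = -(π / 2 - sinIntegral x - A) := by
    rw [hA]; ring
  rw [e2, abs_neg]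
  exact this

/-- **`Si(4π)` enclosed**: `|Si(4π) − (π/2 − 1/(4π) + 2/(4π)³)| ≤ 6/(4π)⁴` (`cos 4π = 1`, `sin 4π = 0`),
i.e. `Si(4π) = 1.4922… ± 2.4·10⁻⁴`; hence `δ(1) = 2(Si(4π)/(4π)+1)` (`traceRemainder_one`) is enclosed
without numerics. [cite: ConnesConsani2021, Remark 4.6 (i) §4 p. 18 ("one checks numerically that both sides are ∼ 2.237484835", arXiv chunk p0018:L2–L5); Titchmarsh1948, §1.9] -/
theorem abs_sinIntegral_four_pi_sub_le :
    |sinIntegral (4 * π) - (π / 2 - 1 / (4 * π) + 2 / (4 * π) ^ 3)| ≤ 6 / (4 * π) ^ 4 := by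
  have h := abs_sinIntegral_sub_expansion_le (x := 4 * π) (by positivity)
  have hc : Real.cos (4 * π) = 1 := by
    rw [show (4 : ℝ) * π = (2 : ℕ) * (2 * π) by push_cast; ring, Real.cos_nat_mul_two_pi]
  have hs : Real.sin (4 * π) = 0 := by
    rw [show (4 : ℝ) * π = (4 : ℕ) * π by push_cast; ring, Real.sin_nat_mul_pi]
  rw [hc, hs] at h
  simpa [mul_comm] using h

end HigherOrder

end Literature.NumberTheory.ConnesConsani2021

end
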